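import Summits.QuantumFields.YangMills.Theorems.BalabanUVNodesN15KingModelAnalyticBlockCovGauge
import Summits.QuantumFields.YangMills.Theorems.BalabanUVNodesN15KingModelCovariantDeterminantBounds
import HarnessLib

/-!
# BalabanUVNodes ∕ N15 — THE KING-MODEL RUNG (PART Ϭ-a): THE RG DETERMINANT IDENTITY AT EVERY BACKGROUND — `det A(U,V) = a^{N}·det B(U,V)·det C(U,V)` —
# the three Gaussian normalisations of the one-level model (King's fine fluctuation operator `A = B + aQ♯_K Q` WITH the block term, the fine covariance operator `B = −cΔ_{U,V}+m²`, and
# NE2's unit layer `C = (Δ_eff)⁻¹`) are tied by the matrix determinant lemma at EVERY two-sided complex link field where `B` is invertible; hence `det Δ_eff(U,V)·det A(U,V) = a^{N}·det B(U,V)`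
# in the complex window, `det Δ_eff(U)·det A₀(U) = a^{N}·det(−cΔ_U+m²)` with three POSITIVE factors at every unitary `U`, and KING's `ln[Z(U)Z(1)⁻¹]` ((3.90)) SPLITS into the fine shift
# minus the block-field shift — PART Ε-q's `U ≡ 1` identity continued to every background; gauge invariance of all three determinants under the complexified gauge group
# (Track A, DAG node N15 = NE2; FAN-OUT v1.1 §N15 s3 «KING-MODEL RUNG … + what the curved case adds»; count-neutral)

HONEST FRAMING.  Count-neutral (cell `pub-ymgap`, seat `pub-ymgap-dag-n15-e` g53; `--supports stmt-QuantumFields-27247 --as helper` = K3ᴬ, KEY MAP v3).  King's one-level comparison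
model with Bałaban's covariant block mean along a tree contour system; determinants of finite matrices; the identity is the SHAPE of King's normalisation bookkeeping (2.4)–(2.6) ∕ (3.89)–(3.90)
(`Z_k(A)`, `N_k`) for the model's one-level operators — NOT King's multi-step `Z_k` as printed, NOT the loop expansion (3.94)–(3.98), NOT Ward identities; NOT a node discharge (N15 of record
untouched); nothing continuum ∕ ℝ⁴ ∕ OS ∕ Clay.

THE RESULTS (`N = |T₁|·|n|` the block degrees of freedom; `A(U,V) = cxFullOp a`, `B(U,V) = cxFullOp 0`, `C(U,V) = cxBlockCov`, `Δ_eff(U,V) = cxEffLap`):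
* §1 (generic, any field) `det_eq_det_mul_det_one_add_smul` (`A = B + a·YX`, `B` invertible ⟹ `det A = det B·det(1 + a·XB⁻¹Y)`), ★★ `det_eq_pow_mul_det_mul_det` (`a ≠ 0` ⟹ `det A = a^{|p|}·det B·det(a⁻¹1 + XB⁻¹Y)`).
* §2 ★★★ **`det_cxFullOp_eq_pow_mul_det_mul_det`** (`IsUnit B(U,V)`, `a ≠ 0` ⟹ `det A(U,V) = a^{N}·det B(U,V)·det C(U,V)` at EVERY two-sided complex link field), ★★★ **`det_cxEffLap_mul_det_cxFullOp`**
  (`+ IsUnit A(U,V)` ⟹ `det Δ_eff(U,V)·det A(U,V) = a^{N}·det B(U,V)`), `det_cxEffLap_eq_div`, `det_cxBlockCov_eq_div`, `det_cxFullOp_ne_zero_iff` (given `IsUnit B`: `det A ≠ 0 ↔ det C ≠ 0`).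
* §3 THE REAL SLICE (unitary `U`, `a, m² > 0`, `c ≥ 0`): `re_det_fullOpU_pos` ∕ `det_fullOpU_eq_ofReal_re` (King's fine fluctuation operator has positive real determinant), ★★★ **`det_effLapU_mul_det_fullOpU`**
  (`det Δ_eff(U)·det A₀(U) = a^{N}·det(−cΔ_U+m²)` — PART Ε-q AT EVERY UNITARY BACKGROUND), ★★ `re_det_effLapU_mul_re_det_fullOpU` (real form), ★★ `re_det_effLapU_pos`, `det_effLapU_eq_ofReal_re`,
  ★★★ **`log_re_det_effLapU_eq`** (`ln det Δ_eff(U) = N·ln a + ln det(−cΔ_U+m²) − ln det A₀(U)`), ★★★ **`king_logZ_split`** (for ANY two unitary `U, V`: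
  `[ln det A₀(U) − ln det A₀(V)] = [ln det B(U) − ln det B(V)] − [ln det Δ_eff(U) − ln det Δ_eff(V)]` — King's `ln[Z(U)Z(V)⁻¹]` is the fine (diamagnetic, PART Ͱ-c) shift minus the block-field shift).
* §4 THE COMPLEX WINDOW (`Lε ≤ s₀(m²,a,d)` around a unitary `U₀`, comb depth, King's scaling `c = L²`): ★★★ `det_cxEffLap_mul_det_cxFullOp_at_massRadius`, `det_cxFullOp_at_massRadius_ne_zero`,
  `det_cxFullOp_zero_at_massRadius_ne_zero`, `det_cxBlockCov_at_massRadius_eq_inv`.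
* §5 GAUGE: ★★ `det_cxFullOp_cxGauge` (`det A(g·U,g·V) = det A(U,V)` for pointwise-invertible `g`; with PART Ϫ-k's `det_cxEffLap_cxGauge` ∕ `det_cxBlockCov_cxGauge` all three normalisations are
  invariants of the complexified gauge group).
PRIOR TREE ART (by name): Ε-q `det_fineOp_mul_det_effLaplacian` (`U ≡ 1`, `King1986.Torus` carriers — the identity continued here; not imported, different carriers), Ͱ-c (`det_covLapF_eq_ofReal_re`,
`re_det_covLapF_pos`), Ϥ-k (`posDef_fullOpU_massive`, `isUnit_fullOpU_massive`, `isUnit_effLapU`, `fullOpU_eq_covLapF_add`), Ϩ-a (`cxFullOp_adjoint`), Ϩ-l (`cxEffLap_adjoint`), Ϫ-a (`cxBlockCov`,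
`cxFullOp_eq_zero_add_blockTerm`, `cxEffLap_mul_cxBlockCov`, `cxFullOp_zero_adjoint_eq_covLapF`), Ϫ-b (`isUnit_cxFullOp_zero_at_massRadius`, `isUnit_cxEffLap_at_massRadius`,
`cxEffLap_mul_cxBlockCov_at_massRadius`), Ϩ-g (`isUnit_cxFullOp_at_radius`), Ϫ-k (`cxFullOp_cxGauge`), Mathlib (`Matrix.det_add_mul` — the matrix determinant lemma, `Matrix.det_smul`,
`Matrix.det_conj`, `Matrix.PosDef.det_pos`).  Dedup (rg at filing): basename 0 files; needles `det_cxFullOp_eq_pow_mul_det_mul_det|det_cxEffLap_mul_det_cxFullOp|det_effLapU_mul_det_fullOpU|king_logZ_split|det_cxFullOp_cxGauge`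
0 tree files.  Locators: [King1986] (2.4)–(2.6) p.652, (2.13)–(2.14) p.653, (3.89) p.668, (3.90) p.669, (4.44) p.675; [Balaban1985BackgroundPropagators] (3.24)–(3.25) p.394, (3.32) p.395, §3.B p.399 l.37–40,
Thm 3.4 p.400.  0 `sorry`, 0 `def`.
-/

noncomputable section
open scoped BigOperators ComplexConjugate ComplexOrder Matrix.Norms.L2Operator
open Finset Matrix

namespace Summit.QuantumFields.YangMills.BalabanUVNodes.N15KingModelRung.Analytic

open Literature.MathematicalPhysics.QuantumFieldTheory.Balaban1983to89.B5Prop11Plancherel (Tor fine)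
open Summit.QuantumFields.YangMills.BalabanUVNodes.N15KingModelRung.Covariant (covLapF kingGaugeMat cxGaugeFwd cxGaugeBwd kingGaugeMat_inv_eq isUnit_kingGaugeMat
  det_covLapF_eq_ofReal_re re_det_covLapF_pos)
open Summit.QuantumFields.YangMills.BalabanUVNodes.N15KingModelRung.CovariantBlock (BlockTree covQ fullOpU effLapU posDef_fullOpU_massive isUnit_fullOpU_massive isUnit_effLapU
  fullOpU_eq_covLapF_add cornerGauge)

/-! ## §1 The matrix determinant lemma in King's letters -/

section Generic

variable {𝕜 : Type*} [Field 𝕜] {p q : Type*} [Fintype p] [DecidableEq p] [Fintype q] [DecidableEq q]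

/-- `A = B + a·YX` with `B` invertible ⟹ `det A = det B·det(1 + a·XB⁻¹Y)` (the matrix determinant lemma ∕ Weinstein–Aronszajn, Mathlib's `Matrix.det_add_mul`).
[cite: King1986, (2.4)–(2.6) p.652, (2.13) p.653] -/
theorem det_eq_det_mul_det_one_add_smul (a : 𝕜) {X : Matrix p q 𝕜} {Y : Matrix q p 𝕜} {A B : Matrix q q 𝕜} (hAB : A = B + a • (Y * X)) (hB : IsUnit B) :
    A.det = B.det * (1 + a • (X * B⁻¹ * Y)).det := by
  rw [hAB, show a • (Y * X) = (a • Y) * X from (Matrix.smul_mul a Y X).symm, Matrix.det_add_mul (a • Y) X ((Matrix.isUnit_iff_isUnit_det _).mp hB), Matrix.mul_smul]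

/-- ★★ `A = B + a·YX`, `B` invertible, `a ≠ 0` ⟹ `det A = a^{|p|}·det B·det(a⁻¹1 + XB⁻¹Y)` — the determinant of the fine operator WITH the block term is `a^{N}` times the fine determinant
times the determinant of the Woodbury form. [cite: King1986, (2.4)–(2.6) p.652, (2.13)–(2.14) p.653, (4.44) p.675] -/
theorem det_eq_pow_mul_det_mul_det {a : 𝕜} (ha : a ≠ 0) {X : Matrix p q 𝕜} {Y : Matrix q p 𝕜} {A B : Matrix q q 𝕜} (hAB : A = B + a • (Y * X)) (hB : IsUnit B) :
    A.det = a ^ Fintype.card p * B.det * (a⁻¹ • (1 : Matrix p p 𝕜) + X * B⁻¹ * Y).det := by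
  have h1 : (1 : Matrix p p 𝕜) + a • (X * B⁻¹ * Y) = a • (a⁻¹ • (1 : Matrix p p 𝕜) + X * B⁻¹ * Y) := by
    rw [smul_add, smul_smul, mul_inv_cancel₀ ha, one_smul]
  rw [det_eq_det_mul_det_one_add_smul a hAB hB, h1, Matrix.det_smul]
  ring

end Generic

variable {d : ℕ} {L : ℕ} [NeZero L] (T : BlockTree d L) (M : Fin (d + 1) → ℕ) [hM : ∀ μ, NeZero (M μ)]
variable {𝕜 : Type*} [RCLike 𝕜] {n : Type*} [Fintype n] [DecidableEq n]

/-! ## §2 The identity at every two-sided complex link field -/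

section Complex

variable {a c m2 : ℝ} {U V : Tor (fine L M) × Fin (d + 1) → Matrix n n 𝕜}

/-- ★★★ **THE RG DETERMINANT IDENTITY AT EVERY TWO-SIDED COMPLEX LINK FIELD**: `IsUnit B(U,V)`, `a ≠ 0` ⟹ `det A(U,V) = a^{N}·det B(U,V)·det C(U,V)` — King's fine fluctuation operator WITH the
block term, the continued fine covariance operator, and the Woodbury form of NE2's unit layer (PART Ϫ-a). No invertibility of `A` is needed. [cite: King1986, (2.4)–(2.6) p.652, (2.13)–(2.14) p.653, (3.89) p.668, (4.44) p.675; Balaban1985BackgroundPropagators, §3.B p.399 l.37–40] -/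
theorem det_cxFullOp_eq_pow_mul_det_mul_det (ha : a ≠ 0) (hB : IsUnit (cxFullOp T M 0 c m2 U V)) :
    (cxFullOp T M a c m2 U V).det = (a : 𝕜) ^ Fintype.card (Tor M × n) * (cxFullOp T M 0 c m2 U V).det * (cxBlockCov T M a c m2 U V).det := by
  have ha' : (a : 𝕜) ≠ 0 := by exact_mod_cast ha
  rw [det_eq_pow_mul_det_mul_det ha' (cxFullOp_eq_zero_add_blockTerm T M a c m2 U V) hB, cxBlockCov]

/-- ★★★ **`det Δ_eff(U,V)·det A(U,V) = a^{N}·det B(U,V)`** wherever `A(U,V)` and `B(U,V)` are invertible (`a ≠ 0`) — PART Ε-q's `det A₀·det Δ^{(K)} = a^{|Ω|}·det B` continued off `U ≡ 1`.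
[cite: King1986, (2.4)–(2.6) p.652, (2.14) p.653, (3.89)–(3.90) pp.668–669, (4.44) p.675; Balaban1985BackgroundPropagators, Thm 3.4 p.400] -/
theorem det_cxEffLap_mul_det_cxFullOp (ha : a ≠ 0) (hA : IsUnit (cxFullOp T M a c m2 U V)) (hB : IsUnit (cxFullOp T M 0 c m2 U V)) :
    (cxEffLap T M a c m2 U V).det * (cxFullOp T M a c m2 U V).det = (a : 𝕜) ^ Fintype.card (Tor M × n) * (cxFullOp T M 0 c m2 U V).det := by
  have hCE : (cxEffLap T M a c m2 U V).det * (cxBlockCov T M a c m2 U V).det = 1 := by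
    rw [← Matrix.det_mul, cxEffLap_mul_cxBlockCov T M ha hA hB, Matrix.det_one]
  rw [det_cxFullOp_eq_pow_mul_det_mul_det T M ha hB]
  calc (cxEffLap T M a c m2 U V).det * ((a : 𝕜) ^ Fintype.card (Tor M × n) * (cxFullOp T M 0 c m2 U V).det * (cxBlockCov T M a c m2 U V).det)
        = (a : 𝕜) ^ Fintype.card (Tor M × n) * (cxFullOp T M 0 c m2 U V).det * ((cxEffLap T M a c m2 U V).det * (cxBlockCov T M a c m2 U V).det) := by ring
    _ = (a : 𝕜) ^ Fintype.card (Tor M × n) * (cxFullOp T M 0 c m2 U V).det := by rw [hCE, mul_one]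

/-- `det Δ_eff(U,V) = a^{N}·det B(U,V) ∕ det A(U,V)` there. [cite: King1986, (2.14) p.653, (3.90) p.669, (4.44) p.675] -/
theorem det_cxEffLap_eq_div (ha : a ≠ 0) (hA : IsUnit (cxFullOp T M a c m2 U V)) (hB : IsUnit (cxFullOp T M 0 c m2 U V)) :
    (cxEffLap T M a c m2 U V).det = (a : 𝕜) ^ Fintype.card (Tor M × n) * (cxFullOp T M 0 c m2 U V).det / (cxFullOp T M a c m2 U V).det := by
  have hA' : (cxFullOp T M a c m2 U V).det ≠ 0 := ((Matrix.isUnit_iff_isUnit_det _).mp hA).ne_zero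
  rw [eq_div_iff hA', det_cxEffLap_mul_det_cxFullOp T M ha hA hB]

/-- `det C(U,V) = det A(U,V) ∕ (a^{N}·det B(U,V))` wherever `B(U,V)` is invertible. [cite: King1986, (2.14) p.653, (4.44) p.675] -/
theorem det_cxBlockCov_eq_div (ha : a ≠ 0) (hB : IsUnit (cxFullOp T M 0 c m2 U V)) :
    (cxBlockCov T M a c m2 U V).det = (cxFullOp T M a c m2 U V).det / ((a : 𝕜) ^ Fintype.card (Tor M × n) * (cxFullOp T M 0 c m2 U V).det) := by
  have ha' : (a : 𝕜) ≠ 0 := by exact_mod_cast ha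
  have hB' : (cxFullOp T M 0 c m2 U V).det ≠ 0 := ((Matrix.isUnit_iff_isUnit_det _).mp hB).ne_zero
  rw [eq_div_iff (mul_ne_zero (pow_ne_zero _ ha') hB'), det_cxFullOp_eq_pow_mul_det_mul_det T M ha hB]
  ring

/-- Given `IsUnit B(U,V)` and `a ≠ 0`: `A(U,V)` is invertible iff the Woodbury form `C(U,V)` has non-zero determinant — the windows of the fine fluctuation operator and of NE2's unit layer
coincide (PART Ϫ-i's pole statement in determinant currency). [cite: King1986, (2.14) p.653, (4.44) p.675; Balaban1985BackgroundPropagators, Thm 3.4 p.400] -/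
theorem det_cxFullOp_ne_zero_iff (ha : a ≠ 0) (hB : IsUnit (cxFullOp T M 0 c m2 U V)) :
    (cxFullOp T M a c m2 U V).det ≠ 0 ↔ (cxBlockCov T M a c m2 U V).det ≠ 0 := by
  have ha' : (a : 𝕜) ≠ 0 := by exact_mod_cast ha
  have hB' : (cxFullOp T M 0 c m2 U V).det ≠ 0 := ((Matrix.isUnit_iff_isUnit_det _).mp hB).ne_zero
  rw [det_cxFullOp_eq_pow_mul_det_mul_det T M ha hB]
  simp only [ne_eq, mul_eq_zero, pow_eq_zero_iff', ha', hB', false_and, false_or, or_false]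

end Complex

/-! ## §3 The real slice: three positive normalisations at every unitary background -/

section RealSlice

variable {a c m2 : ℝ} (ha : 0 < a) (hc : 0 ≤ c) (hm : 0 < m2) {U : Tor (fine L M) × Fin (d + 1) → Matrix n n 𝕜} (hU : ∀ bd, U bd ∈ Matrix.unitaryGroup n 𝕜)
include hc hm hU

/-- KING's FINE FLUCTUATION OPERATOR HAS POSITIVE DETERMINANT at every unitary background (`a ≥ 0`, `c ≥ 0`, `m² > 0`; positive definite, PART Ϥ-k): `0 < Re det A₀(U)`.
[cite: King1986, (2.13) p.653, (3.89) p.668; Balaban1985BackgroundPropagators, (3.24)–(3.25) p.394] -/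
theorem re_det_fullOpU_pos (ha : 0 ≤ a) : 0 < RCLike.re (fullOpU T M a c m2 U).det :=
  (RCLike.pos_iff.mp (posDef_fullOpU_massive T M ha hc hm hU).det_pos).1

/-- … and it is REAL: `det A₀(U) = Re det A₀(U)`. [cite: King1986, (2.13) p.653] -/
theorem det_fullOpU_eq_ofReal_re (ha : 0 ≤ a) : (fullOpU T M a c m2 U).det = ((RCLike.re (fullOpU T M a c m2 U).det : ℝ) : 𝕜) := by
  have h := RCLike.pos_iff.mp (posDef_fullOpU_massive T M ha hc hm hU).det_pos
  refine (RCLike.re_add_im _).symm.trans ?_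
  rw [h.2]
  simp

include ha

/-- ★★★ **PART Ε-q AT EVERY UNITARY BACKGROUND**: `det Δ_eff(U)·det A₀(U) = a^{N}·det(−cΔ_U+m²)` — the RG determinant identity tying King's block-field normalisation, the fine fluctuation
normalisation WITH the block term and the minimally coupled fine normalisation, at EVERY unitary `U` (any curvature, any volume, any fibre, any contour system).
[cite: King1986, (2.4)–(2.6) p.652, (2.13)–(2.14) p.653, (3.89)–(3.90) pp.668–669, (4.44) p.675; Balaban1985BackgroundPropagators, (3.24)–(3.25) p.394] -/
theorem det_effLapU_mul_det_fullOpU :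
    (effLapU T M a c m2 U).det * (fullOpU T M a c m2 U).det = (a : 𝕜) ^ Fintype.card (Tor M × n) * (covLapF (fine L M) c m2 U).det := by
  have hA : IsUnit (cxFullOp T M a c m2 U (fun bd => (U bd)ᴴ)) := by rw [cxFullOp_adjoint]; exact isUnit_fullOpU_massive T M ha.le hc hm hU
  have hB : IsUnit (cxFullOp T M 0 c m2 U (fun bd => (U bd)ᴴ)) := by rw [cxFullOp_adjoint]; exact isUnit_fullOpU_massive T M le_rfl hc hm hU
  have h := det_cxEffLap_mul_det_cxFullOp T M ha.ne' hA hB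
  rwa [cxEffLap_adjoint, cxFullOp_adjoint, cxFullOp_zero_adjoint_eq_covLapF] at h

/-- ★★ The same among REAL numbers: `Re det Δ_eff(U)·Re det A₀(U) = a^{N}·Re det(−cΔ_U+m²)`. [cite: King1986, (2.14) p.653, (3.89)–(3.90) pp.668–669] -/
theorem re_det_effLapU_mul_re_det_fullOpU :
    RCLike.re (effLapU T M a c m2 U).det * RCLike.re (fullOpU T M a c m2 U).det = a ^ Fintype.card (Tor M × n) * RCLike.re (covLapF (fine L M) c m2 U).det := by
  have h := congrArg RCLike.re (det_effLapU_mul_det_fullOpU T M ha hc hm hU)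
  rw [det_fullOpU_eq_ofReal_re T M hc hm hU ha.le, RCLike.re_mul_ofReal, ← RCLike.ofReal_pow, RCLike.re_ofReal_mul] at h
  exact h

/-- ★★ **THE BLOCK-FIELD NORMALISATION IS POSITIVE**: `0 < Re det Δ_eff(U)` at every unitary `U`. [cite: King1986, (2.14) p.653, (3.89) p.668] -/
theorem re_det_effLapU_pos : 0 < RCLike.re (effLapU T M a c m2 U).det := by
  have h := re_det_effLapU_mul_re_det_fullOpU T M ha hc hm hU
  have hA := re_det_fullOpU_pos T M hc hm hU ha.le
  have hB := re_det_covLapF_pos (fine L M) (n := n) hc hm hU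
  have hrhs : 0 < a ^ Fintype.card (Tor M × n) * RCLike.re (covLapF (fine L M) c m2 U).det := mul_pos (pow_pos ha _) hB
  rw [← h] at hrhs
  exact pos_of_mul_pos_left hrhs hA.le

/-- `det Δ_eff(U)` is REAL: `det Δ_eff(U) = Re det Δ_eff(U)`. [cite: King1986, (2.14) p.653] -/
theorem det_effLapU_eq_ofReal_re : (effLapU T M a c m2 U).det = ((RCLike.re (effLapU T M a c m2 U).det : ℝ) : 𝕜) := by
  have hA0 : RCLike.re (fullOpU T M a c m2 U).det ≠ 0 := (re_det_fullOpU_pos T M hc hm hU ha.le).ne'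
  have hA0' : (fullOpU T M a c m2 U).det ≠ 0 := by rw [det_fullOpU_eq_ofReal_re T M hc hm hU ha.le]; exact_mod_cast hA0
  have h := det_effLapU_mul_det_fullOpU T M ha hc hm hU
  rw [det_fullOpU_eq_ofReal_re T M hc hm hU ha.le, det_covLapF_eq_ofReal_re (fine L M) hc hm U] at h
  have h' : (effLapU T M a c m2 U).det = ((a : 𝕜) ^ Fintype.card (Tor M × n) * ((RCLike.re (covLapF (fine L M) c m2 U).det : ℝ) : 𝕜)) / ((RCLike.re (fullOpU T M a c m2 U).det : ℝ) : 𝕜) := by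
    rw [eq_div_iff (by exact_mod_cast hA0), h]
  rw [h', ← RCLike.ofReal_pow, ← RCLike.ofReal_mul, ← RCLike.ofReal_div, RCLike.ofReal_re]

/-- ★★★ **THE LOGARITHMIC FORM**: `ln det Δ_eff(U) = N·ln a + ln det(−cΔ_U+m²) − ln det A₀(U)` at every unitary `U` — the block-field normalisation is the fine normalisation WITHOUT the
block term over the one WITH it, times `a^{N}`. [cite: King1986, (2.6) p.652, (3.89)–(3.90) pp.668–669] -/
theorem log_re_det_effLapU_eq :
    Real.log (RCLike.re (effLapU T M a c m2 U).det)
      = Fintype.card (Tor M × n) * Real.log a + Real.log (RCLike.re (covLapF (fine L M) c m2 U).det) - Real.log (RCLike.re (fullOpU T M a c m2 U).det) := by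
  have h := re_det_effLapU_mul_re_det_fullOpU T M ha hc hm hU
  have hA := re_det_fullOpU_pos T M hc hm hU ha.le
  have hΔ := re_det_effLapU_pos T M ha hc hm hU
  have hB := re_det_covLapF_pos (fine L M) (n := n) hc hm hU
  have hlog := congrArg Real.log h
  rw [Real.log_mul hΔ.ne' hA.ne', Real.log_mul (pow_pos ha _).ne' hB.ne', Real.log_pow] at hlog
  linarith

omit hU in
/-- ★★★ **KING's `ln[Z(U)Z(V)⁻¹]` SPLITS**: for ANY two unitary backgrounds `U, V`,
`[ln det A₀(U) − ln det A₀(V)] = [ln det(−cΔ_U+m²) − ln det(−cΔ_V+m²)] − [ln det Δ_eff(U) − ln det Δ_eff(V)]` — the change of the fine fluctuation normalisation WITH the block term is the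
minimally coupled (diamagnetic, PART Ͱ-c) shift minus the block-field shift; the `a^{N}` cancels. [cite: King1986, (3.89)–(3.90) pp.668–669, (3.94) p.669] -/
theorem king_logZ_split {U V : Tor (fine L M) × Fin (d + 1) → Matrix n n 𝕜} (hU : ∀ bd, U bd ∈ Matrix.unitaryGroup n 𝕜) (hV : ∀ bd, V bd ∈ Matrix.unitaryGroup n 𝕜) :
    Real.log (RCLike.re (fullOpU T M a c m2 U).det) - Real.log (RCLike.re (fullOpU T M a c m2 V).det)
      = (Real.log (RCLike.re (covLapF (fine L M) c m2 U).det) - Real.log (RCLike.re (covLapF (fine L M) c m2 V).det))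
        - (Real.log (RCLike.re (effLapU T M a c m2 U).det) - Real.log (RCLike.re (effLapU T M a c m2 V).det)) := by
  have h1 := log_re_det_effLapU_eq T M ha hc hm hU
  have h2 := log_re_det_effLapU_eq T M ha hc hm hV
  linarith

end RealSlice

/-! ## §4 The complex window around every unitary background -/

section Window

variable (hD : ∀ j, T.depth j ≤ (d + 1) * (L - 1)) {a m2 : ℝ} (ha : 0 < a) (hm : 0 < m2) (hL : 1 ≤ L)
variable {U₀ : Tor (fine L M) × Fin (d + 1) → Matrix n n 𝕜} (hU₀ : ∀ bd, U₀ bd ∈ Matrix.unitaryGroup n 𝕜)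
variable {U : Tor (fine L M) × Fin (d + 1) → Matrix n n 𝕜} {ε : ℝ} (hε0 : 0 ≤ ε) (hU : ∀ bd, ‖U bd - U₀ bd‖ ≤ ε) (hrad : (L : ℝ) * ε ≤ sliceRadius m2 a d)
include hD ha hm hL hU₀ hε0 hU hrad

/-- ★★★ **THE IDENTITY IN THE POLYDISC**: at `Lε ≤ s₀(m²,a,d)` around any unitary `U₀` (King's scaling `c = L²`, comb depth), `det Δ_eff(U,U⁻¹)·det A(U,U⁻¹) = a^{N}·det B(U,U⁻¹)` — the three
continued normalisations are tied throughout PART Ϫ-b's window. [cite: King1986, (2.14) p.653, (3.90) p.669, (4.44) p.675; Balaban1985BackgroundPropagators, Thm 3.4 p.400] -/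
theorem det_cxEffLap_mul_det_cxFullOp_at_massRadius :
    (cxEffLap T M a ((L : ℝ) ^ 2) m2 U (fun bd => (U bd)⁻¹)).det * (cxFullOp T M a ((L : ℝ) ^ 2) m2 U (fun bd => (U bd)⁻¹)).det
      = (a : 𝕜) ^ Fintype.card (Tor M × n) * (cxFullOp T M 0 ((L : ℝ) ^ 2) m2 U (fun bd => (U bd)⁻¹)).det :=
  det_cxEffLap_mul_det_cxFullOp T M ha.ne'
    (isUnit_cxFullOp_at_radius T M hD ha.le hm.le hL hU₀ hm (mass_coercive_fullOpU T M ha.le (by positivity) m2 hU₀) hε0 hU hrad)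
    (isUnit_cxFullOp_zero_at_massRadius T M hD ha hm hL hU₀ hε0 hU hrad)

/-- `det A(U,U⁻¹) ≠ 0` in the window. [cite: Balaban1985BackgroundPropagators, Thm 3.4 p.400] -/
theorem det_cxFullOp_at_massRadius_ne_zero : (cxFullOp T M a ((L : ℝ) ^ 2) m2 U (fun bd => (U bd)⁻¹)).det ≠ 0 :=
  ((Matrix.isUnit_iff_isUnit_det _).mp
    (isUnit_cxFullOp_at_radius T M hD ha.le hm.le hL hU₀ hm (mass_coercive_fullOpU T M ha.le (by positivity) m2 hU₀) hε0 hU hrad)).ne_zero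

/-- `det B(U,U⁻¹) ≠ 0` in the window. [cite: Balaban1985BackgroundPropagators, Thm 3.4 p.400] -/
theorem det_cxFullOp_zero_at_massRadius_ne_zero : (cxFullOp T M 0 ((L : ℝ) ^ 2) m2 U (fun bd => (U bd)⁻¹)).det ≠ 0 :=
  ((Matrix.isUnit_iff_isUnit_det _).mp (isUnit_cxFullOp_zero_at_massRadius T M hD ha hm hL hU₀ hε0 hU hrad)).ne_zero

/-- In the window the Woodbury form carries the inverse normalisation: `det C(U,U⁻¹) = (det Δ_eff(U,U⁻¹))⁻¹`. [cite: King1986, (2.14) p.653, (4.44) p.675] -/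
theorem det_cxBlockCov_at_massRadius_eq_inv :
    (cxBlockCov T M a ((L : ℝ) ^ 2) m2 U (fun bd => (U bd)⁻¹)).det = ((cxEffLap T M a ((L : ℝ) ^ 2) m2 U (fun bd => (U bd)⁻¹)).det)⁻¹ := by
  have h : (cxEffLap T M a ((L : ℝ) ^ 2) m2 U (fun bd => (U bd)⁻¹)).det * (cxBlockCov T M a ((L : ℝ) ^ 2) m2 U (fun bd => (U bd)⁻¹)).det = 1 := by
    rw [← Matrix.det_mul, cxEffLap_mul_cxBlockCov_at_massRadius T M hD ha hm hL hU₀ hε0 hU hrad, Matrix.det_one]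
  exact (eq_inv_of_mul_eq_one_right h)

end Window

/-! ## §5 Gauge invariance of the fine fluctuation normalisation -/

section Gauge

variable {g : Tor (fine L M) → Matrix n n 𝕜} (hg : ∀ x, IsUnit (g x)) (a c m2 : ℝ) (U V : Tor (fine L M) × Fin (d + 1) → Matrix n n 𝕜)
include hg

/-- ★★ **`det A(g·U, g·V) = det A(U,V)`** for every pointwise-invertible (complexified) gauge transformation `g` (PART Ϫ-k's conjugation `A(g·U,g·V) = D_gA(U,V)D_{g⁻¹}`); with PART Ϫ-k's
`det_cxEffLap_cxGauge` and `det_cxBlockCov_cxGauge`, all three Gaussian normalisations are invariants of the complexified gauge group. [cite: Balaban1985BackgroundPropagators, (3.32) p.395, (3.34) p.396; King1986, (2.13) p.653] -/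
theorem det_cxFullOp_cxGauge :
    (cxFullOp T M a c m2 (cxGaugeFwd (fine L M) g U) (cxGaugeBwd (fine L M) g V)).det = (cxFullOp T M a c m2 U V).det := by
  have hP : IsUnit (kingGaugeMat (fine L M) g) := isUnit_kingGaugeMat (fine L M) hg
  rw [cxFullOp_cxGauge T M hg, ← kingGaugeMat_inv_eq (fine L M) hg, Matrix.det_conj hP]

end Gauge

end Summit.QuantumFields.YangMills.BalabanUVNodes.N15KingModelRung.Analytic

end
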